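import Literature.NumberTheory.EllipticCurves.ZpExtensionEisensteinAdicTowerReadoutColimit
import Literature.NumberTheory.EllipticCurves.IwasawaSelmerDualEisensteinQuotientProofs
import HarnessLib

/-!
# `Sel_∞[ψ_m] ⧸ readout(H¹_F(K, A)) ≅ H¹(K, A)_{Sel} ⧸ H¹_F(K, A)` for a bijective readout
# `H¹(K, A) ≅ H¹(K_∞, E[p^∞])[ψ_m]` (Howard Prop. 2.2.8, second map — the bookkeeping half) — proofs file

Topic `NumberTheory/EllipticCurves`. THEOREMS ONLY: no definition, no named fact, no instance, no `sorry`. Setting-free: any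
abelian group `H₁` (Howard's `H¹(K, A_𝔮)`), any subgroup `𝒮 ≤ H₁` (Howard's `H¹_F(K, A_𝔮)`), any additive readout
`ι₀ : H₁ → H¹(K_∞, E[p^∞])`.

WHY (cell `pub/bsd-print-x9`, shared μ-crux `MuInequalityCoherentPairOfPrint{,CG}`, STUB B, the registered clause
`HeegnerMuPartControlGlue.Stmt.readoutIndex` (B5, p670216); seat `bsd-line-x10b-p1-w2` g10, brick (B5-quot)). The clause bounds
`Q := Sel_∞[ψ_m] ⧸ (ι₀(𝒮) ∩ Sel_∞)`, `ψ_m = (conj_γ − 1)^m + p`. When `ι₀` is INJECTIVE (B1, `eisensteinTowerReadout_injective`)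
and ONTO the `ψ_m`-torsion of `H¹(K_∞, E[p^∞])` (B2, `exists_eisensteinTowerReadout_eq`) and kills `ψ_m` (p662975), the map
`a ↦ ι₀ a` identifies `H₁_{Sel} := ι₀⁻¹(Sel_∞)` with `Sel_∞[ψ_m]` and `𝒮 ∩ H₁_{Sel}` with `ι₀(𝒮) ∩ Sel_∞`:
so `Q ≅ H₁_{Sel} ⧸ (𝒮 ∩ H₁_{Sel})` (`= H₁_{Sel} ⧸ 𝒮` once `ι₀(𝒮) ⊆ Sel_∞`, B4) — the index to be bounded is that of Howard's Selmer group inside the classes of `H¹(K, A_𝔮)` that are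
Selmer over `K_∞`, a statement about `H¹(K, A_𝔮)` and local conditions only.

* `exists_addEquiv_selmerComap_kerPsi` — `H₁_{Sel} ≃+ Sel_∞[ψ_m]` through `ι₀`;
* **`nonempty_addEquiv_quotient_of_readout`** — `H₁_{Sel} ⧸ 𝒮 ≃+ Sel_∞[ψ_m] ⧸ (ι₀(𝒮) ∩ Sel_∞)`;
* **`natCard_quotient_eq_of_readout`**, **`finite_quotient_iff_of_readout`** — the two conjuncts of (B5) transported.

References: [Howard2004HeegnerKolyvagin] Prop. 2.2.8 (second map) and proof of Thm. 2.2.10 (𝔮 = T^m + p); [GreenbergLNM1716]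
§4 pp. 98, 124.  BSD is not proved by any of this.
-/

set_option autoImplicit false

noncomputable section

namespace WeierstrassCurve

open Literature.NumberTheory.EllipticCurves Field

variable {K : Type} [Field K] [NumberField K] (V : WeierstrassCurve K) {p : ℕ} [hp : Fact p.Prime]
  (κ : ZpExtension K p) (γ : absoluteGaloisGroup K) (m : ℕ)
  {H₁ : Type} [AddCommGroup H₁] (𝒮 : AddSubgroup H₁) (ι₀ : H₁ →+ V.subgroupH1 p κ.kerSubgroup)
  (θ : AddMonoid.End (V.subgroupH1 p κ.kerSubgroup)) (hθ : ∀ s, θ s = V.conjH1 p κ.kerSubgroup γ s)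

include hθ in
/-- `ψ_m` on `Sel_∞` and `ψ_m` on `H¹(K_∞, E[p^∞])` agree under the inclusion. [cite: GreenbergLNM1716, §4 p. 98] -/
theorem coe_psi_selmerInfty_apply (s : V.selmerInfty κ) :
    ((((V.conjSelmerInfty κ γ - 1) ^ m + (p : AddMonoid.End (V.selmerInfty κ))) s : V.selmerInfty κ) :
        V.subgroupH1 p κ.kerSubgroup) =
      ((θ - 1) ^ m + (p : AddMonoid.End (V.subgroupH1 p κ.kerSubgroup))) (s : V.subgroupH1 p κ.kerSubgroup) :=
  ZpExtension.apply_psi_apply_of_comm (V.selmerInfty κ).subtype (V.conjSelmerInfty κ γ) θ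
    (fun a ↦ (V.coe_conjSelmerInfty_apply κ γ a).trans (hθ _).symm) m p s

include hθ in
/-- **`H₁_{Sel} := ι₀⁻¹(Sel_∞) ≃+ Sel_∞[ψ_m]` through `ι₀`**, for `ι₀` injective, killing `ψ_m` and onto the `ψ_m`-torsion.
[cite: Howard2004HeegnerKolyvagin, Prop. 2.2.8 and proof of Thm. 2.2.10] [cite: GreenbergLNM1716, §4 pp. 98, 124] -/
theorem exists_addEquiv_selmerComap_kerPsi (hinj : Function.Injective ι₀)
    (hψ : ∀ a, ((θ - 1) ^ m + (p : AddMonoid.End (V.subgroupH1 p κ.kerSubgroup))) (ι₀ a) = 0)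
    (hsurj : ∀ s, ((θ - 1) ^ m + (p : AddMonoid.End (V.subgroupH1 p κ.kerSubgroup))) s = 0 → ∃ a, ι₀ a = s) :
    ∃ e : ↥((V.selmerInfty κ).comap ι₀) ≃+
        ↥(((V.conjSelmerInfty κ γ - 1) ^ m + (p : AddMonoid.End (V.selmerInfty κ))).ker),
      ∀ a, ((e a : V.selmerInfty κ) : V.subgroupH1 p κ.kerSubgroup) = ι₀ a := by
  -- the map `a ↦ ι₀ a` into `Sel_∞`, then into `Sel_∞[ψ_m]`
  let f₁ : ↥((V.selmerInfty κ).comap ι₀) →+ V.selmerInfty κ :=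
    (ι₀.comp ((V.selmerInfty κ).comap ι₀).subtype).codRestrict (V.selmerInfty κ) (fun a ↦ a.2)
  have hf₁ : ∀ a, (f₁ a : V.subgroupH1 p κ.kerSubgroup) = ι₀ a := fun _ ↦ rfl
  have hker : ∀ a, f₁ a ∈ (((V.conjSelmerInfty κ γ - 1) ^ m + (p : AddMonoid.End (V.selmerInfty κ))).ker) := by
    intro a
    rw [AddMonoidHom.mem_ker]
    apply Subtype.ext
    have h1 := V.coe_psi_selmerInfty_apply κ γ m θ hθ (f₁ a)
    rw [hf₁, hψ] at h1
    exact h1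
  let φ : ↥((V.selmerInfty κ).comap ι₀) →+
      ↥(((V.conjSelmerInfty κ γ - 1) ^ m + (p : AddMonoid.End (V.selmerInfty κ))).ker) :=
    f₁.codRestrict _ hker
  have hφ : ∀ a, ((φ a : V.selmerInfty κ) : V.subgroupH1 p κ.kerSubgroup) = ι₀ a := fun _ ↦ rfl
  have hφinj : Function.Injective φ := by
    intro a b hab
    apply Subtype.ext
    apply hinj
    rw [← hφ, ← hφ, hab]
  have hφsurj : Function.Surjective φ := by
    intro s
    have hs0 : (((V.conjSelmerInfty κ γ - 1) ^ m + (p : AddMonoid.End (V.selmerInfty κ))) (s : V.selmerInfty κ)) = 0 :=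
      AddMonoidHom.mem_ker.mp s.2
    have hs : ((θ - 1) ^ m + (p : AddMonoid.End (V.subgroupH1 p κ.kerSubgroup)))
        ((s : V.selmerInfty κ) : V.subgroupH1 p κ.kerSubgroup) = 0 := by
      rw [← V.coe_psi_selmerInfty_apply κ γ m θ hθ, hs0, ZeroMemClass.coe_zero]
    obtain ⟨a, ha⟩ := hsurj _ hs
    have haSel : a ∈ (V.selmerInfty κ).comap ι₀ := by
      rw [AddSubgroup.mem_comap, ha]; exact (s : V.selmerInfty κ).2
    refine ⟨⟨a, haSel⟩, ?_⟩
    apply Subtype.ext; apply Subtype.ext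
    rw [hφ]
    exact ha
  exact ⟨AddEquiv.ofBijective φ ⟨hφinj, hφsurj⟩, hφ⟩

include hθ in
/-- **`H₁_{Sel} ⧸ (𝒮 ∩ H₁_{Sel}) ≃+ Sel_∞[ψ_m] ⧸ (ι₀(𝒮) ∩ Sel_∞)`** (no hypothesis on `ι₀(𝒮)`: both sides intersect with the Selmer classes).
[cite: Howard2004HeegnerKolyvagin, Prop. 2.2.8 and proof of Thm. 2.2.10] [cite: GreenbergLNM1716, §4 pp. 98, 124] -/
theorem nonempty_addEquiv_quotient_of_readout (hinj : Function.Injective ι₀)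
    (hψ : ∀ a, ((θ - 1) ^ m + (p : AddMonoid.End (V.subgroupH1 p κ.kerSubgroup))) (ι₀ a) = 0)
    (hsurj : ∀ s, ((θ - 1) ^ m + (p : AddMonoid.End (V.subgroupH1 p κ.kerSubgroup))) s = 0 → ∃ a, ι₀ a = s) :
    Nonempty (↥((V.selmerInfty κ).comap ι₀) ⧸ 𝒮.addSubgroupOf ((V.selmerInfty κ).comap ι₀) ≃+
      ↥(((V.conjSelmerInfty κ γ - 1) ^ m + (p : AddMonoid.End (V.selmerInfty κ))).ker) ⧸
        ((𝒮.map ι₀).comap (V.selmerInfty κ).subtype).addSubgroupOf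
          (((V.conjSelmerInfty κ γ - 1) ^ m + (p : AddMonoid.End (V.selmerInfty κ))).ker)) := by
  obtain ⟨e, he⟩ := V.exists_addEquiv_selmerComap_kerPsi κ γ m ι₀ θ hθ hinj hψ hsurj
  refine ⟨QuotientAddGroup.congr _ _ e (le_antisymm ?_ ?_)⟩
  · rintro _ ⟨a, ha, rfl⟩
    exact ⟨(a : H₁), ha, (he a).symm⟩
  · intro s hs
    obtain ⟨b, hb, hbs⟩ := hs
    have hbSel : b ∈ (V.selmerInfty κ).comap ι₀ := by
      rw [AddSubgroup.mem_comap, hbs]; exact (s : V.selmerInfty κ).2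
    refine ⟨⟨b, hbSel⟩, hb, ?_⟩
    apply Subtype.ext; apply Subtype.ext
    exact (he ⟨b, hbSel⟩).trans hbs

include hθ in
/-- **`#(Sel_∞[ψ_m] ⧸ (ι₀(𝒮) ∩ Sel_∞)) = #(H₁_{Sel} ⧸ 𝒮)`** under (B1), (B2) and `ψ_m ∘ ι₀ = 0`.
[cite: Howard2004HeegnerKolyvagin, Prop. 2.2.8 and proof of Thm. 2.2.10] [cite: GreenbergLNM1716, §4 pp. 98, 124] -/
theorem natCard_quotient_eq_of_readout (hinj : Function.Injective ι₀)
    (hψ : ∀ a, ((θ - 1) ^ m + (p : AddMonoid.End (V.subgroupH1 p κ.kerSubgroup))) (ι₀ a) = 0)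
    (hsurj : ∀ s, ((θ - 1) ^ m + (p : AddMonoid.End (V.subgroupH1 p κ.kerSubgroup))) s = 0 → ∃ a, ι₀ a = s) :
    Nat.card (↥(((V.conjSelmerInfty κ γ - 1) ^ m + (p : AddMonoid.End (V.selmerInfty κ))).ker) ⧸
        ((𝒮.map ι₀).comap (V.selmerInfty κ).subtype).addSubgroupOf
          (((V.conjSelmerInfty κ γ - 1) ^ m + (p : AddMonoid.End (V.selmerInfty κ))).ker)) =
      Nat.card (↥((V.selmerInfty κ).comap ι₀) ⧸ 𝒮.addSubgroupOf ((V.selmerInfty κ).comap ι₀)) := by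
  obtain ⟨e⟩ := V.nonempty_addEquiv_quotient_of_readout κ γ m 𝒮 ι₀ θ hθ hinj hψ hsurj
  exact (Nat.card_congr e.toEquiv).symm

include hθ in
/-- **`Sel_∞[ψ_m] ⧸ (ι₀(𝒮) ∩ Sel_∞)` is finite iff `H₁_{Sel} ⧸ 𝒮` is** under (B1), (B2) and `ψ_m ∘ ι₀ = 0`.
[cite: Howard2004HeegnerKolyvagin, Prop. 2.2.8 and proof of Thm. 2.2.10] [cite: GreenbergLNM1716, §4 pp. 98, 124] -/
theorem finite_quotient_iff_of_readout (hinj : Function.Injective ι₀)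
    (hψ : ∀ a, ((θ - 1) ^ m + (p : AddMonoid.End (V.subgroupH1 p κ.kerSubgroup))) (ι₀ a) = 0)
    (hsurj : ∀ s, ((θ - 1) ^ m + (p : AddMonoid.End (V.subgroupH1 p κ.kerSubgroup))) s = 0 → ∃ a, ι₀ a = s) :
    Finite (↥(((V.conjSelmerInfty κ γ - 1) ^ m + (p : AddMonoid.End (V.selmerInfty κ))).ker) ⧸
        ((𝒮.map ι₀).comap (V.selmerInfty κ).subtype).addSubgroupOf
          (((V.conjSelmerInfty κ γ - 1) ^ m + (p : AddMonoid.End (V.selmerInfty κ))).ker)) ↔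
      Finite (↥((V.selmerInfty κ).comap ι₀) ⧸ 𝒮.addSubgroupOf ((V.selmerInfty κ).comap ι₀)) := by
  obtain ⟨e⟩ := V.nonempty_addEquiv_quotient_of_readout κ γ m 𝒮 ι₀ θ hθ hinj hψ hsurj
  exact (Equiv.finite_iff e.toEquiv).symm

end WeierstrassCurve

end
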